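import Literature.Computability.Complexity.MatchingSymmetry
import Literature.Computability.Complexity.MatchingAveraging
import Literature.Barriers.PneNP.TSPExtensionComplexityMatchingsOps
import HarnessLib

/-!
# Restriction to `K_{n-2} = K_n ∖ {a, u}`: embeddings, pulled-back matching monomials, and
# extension of perfect matchings (BBCHPRRWZ 2017, proof of Thm 4.9)

Braun–Brown-Cohen–Huq–Pokutta–Raghavendra–Roy–Weitz–Zink, *The matching problem has no small
symmetric SDP*, Math. Program. 165 (2017), proof of Theorem 4.9 (the Claim): "it can be checked
that `L'_{bv}` is zero on all perfect matchings containing `{a,b}` and `{u,v}`. By induction,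
`L'_{bv} ≅_{(𝒫_{n-4}, 2d-3)} 0` (identifying `K_{n-4}` with the graph `K_n ∖ {a, b, u, v}`), from which
`L'_{bv} ≅_{(𝒫_n, 2d-1)} 0` follows by two applications of Lemma 4.8."  This file supplies the
identification step, one pair of vertices at a time:

* `exists_emb_compl_pair` — a vertex embedding `ι : K_m ↪ K_{m+2}` missing exactly `a ≠ u`;
* `pullEdges ι N` — an edge set of `K_{m+2}` avoiding `a, u` pulled back to `K_m`, with
  `polyEmbed ι (x_{N₀}) = x_N` (`polyEmbed_xM_pullEdges`);
* `extendPM ι a u P₀ = ι(P₀) ∪ {au}` — a perfect matching of `K_m` extended to one of `K_{m+2}`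
  (`isPMOn_extendPM`), and the evaluation transport
  `(polyEmbed ι A₀)(χ^{extendPM P₀}) = A₀(χ^{P₀})` (`eval_polyEmbed_extendPM`), together with the
  values of the edge variables at `a` on the extended matching (`eval_X_pair_extendPM`,
  `eval_X_join_extendPM`).

## References

* G. Braun et al., *The matching problem has no small symmetric SDP*, Math. Program. 165 (2017)
  643–662, proof of Thm 4.9 and Lemma 4.8 (arXiv:1504.00703, p. 9). [BraunEtAl2016]
-/

noncomputable section

open MvPolynomial Finset
open Literature.Barriers.PneNP (IsPMOn)

namespace Literature.Computability.Complexity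

namespace Mod2

variable {m : ℕ}

/-! ### Embeddings missing two vertices -/

/-- For `a ≠ u` there is a vertex embedding `K_m ↪ K_{m+2}` whose image is the complement of
`{a, u}`. [cite: BraunEtAl2016, Thm. 4.9 (proof, "identifying K_{n-4} with K_n ∖ {a,b,u,v}")] -/
theorem exists_emb_compl_pair (a u : Fin (m + 2)) (hau : a ≠ u) :
    ∃ ι : Fin m ↪ Fin (m + 2), ∀ v : Fin (m + 2), v ∉ Set.range ι ↔ v = a ∨ v = u := by
  obtain ⟨a', ha'⟩ := Fin.exists_succAbove_eq hau
  refine ⟨(Fin.succAboveEmb a').trans (Fin.succAboveEmb u), fun v => ?_⟩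
  constructor
  · intro hv
    by_contra h
    push Not at h
    obtain ⟨w, hw⟩ := Fin.exists_succAbove_eq h.2
    have hwa : w ≠ a' := by
      rintro rfl
      exact h.1 (hw.symm.trans ha')
    obtain ⟨z, hz⟩ := Fin.exists_succAbove_eq hwa
    exact hv ⟨z, by simp [Fin.succAboveEmb, hz, hw]⟩
  · rintro (rfl | rfl) ⟨z, hz⟩
    · simp only [Function.Embedding.trans_apply] at hz
      change u.succAbove (a'.succAbove z) = _ at hz
      rw [← ha'] at hz
      exact Fin.succAbove_ne a' z (Fin.succAbove_right_injective hz)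
    · exact Fin.succAbove_ne _ _ hz

/-! ### Pulling back edge sets avoiding the missing vertices -/

variable {n : ℕ} (ι : Fin m ↪ Fin n)

/-- The pull-back of an edge set along a vertex embedding. [cite: BraunEtAl2016, Thm. 4.9 (proof)] -/
def pullEdges (N : Finset (KnEdge n)) : Finset (KnEdge m) :=
  univ.filter fun e₀ => edgeMap ι ι.injective e₀ ∈ N

/-- Membership. [cite: BraunEtAl2016, Thm. 4.9 (proof)] -/
theorem mem_pullEdges {N : Finset (KnEdge n)} {e₀ : KnEdge m} :
    e₀ ∈ pullEdges ι N ↔ edgeMap ι ι.injective e₀ ∈ N := by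
  simp [pullEdges]

/-- An edge whose endpoints are in the image is the image of an edge.
[cite: BraunEtAl2016, Thm. 4.9 (proof)] -/
theorem exists_edgeMap_eq {e : KnEdge n} (he : ∀ v : Fin n, v ∈ (e : Sym2 (Fin n)) → v ∈ Set.range ι) :
    ∃ e₀ : KnEdge m, edgeMap ι ι.injective e₀ = e := by
  obtain ⟨s, hs⟩ := e
  induction s using Sym2.ind with
  | _ x y =>
    obtain ⟨x₀, rfl⟩ := he x (Sym2.mem_mk_left x y)
    obtain ⟨y₀, rfl⟩ := he _ (Sym2.mem_mk_right _ y)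
    have hxy : x₀ ≠ y₀ := fun h => hs (Sym2.mk_isDiag_iff.2 (by rw [h]))
    exact ⟨⟨s(x₀, y₀), fun h => hxy (Sym2.mk_isDiag_iff.1 h)⟩, Subtype.ext (by simp [edgeMap])⟩

/-- **Push-forward of the pull-back** of an edge set avoiding the missing vertices.
[cite: BraunEtAl2016, Thm. 4.9 (proof)] -/
theorem map_pullEdges {N : Finset (KnEdge n)} (hN : ∀ v ∈ verts N, v ∈ Set.range ι) :
    (pullEdges ι N).map ⟨edgeMap ι ι.injective, edgeMap_injective _ _⟩ = N := by
  ext e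
  rw [mem_map]
  constructor
  · rintro ⟨e₀, he₀, rfl⟩
    exact (mem_pullEdges ι).1 he₀
  · intro he
    obtain ⟨e₀, rfl⟩ := exists_edgeMap_eq ι (e := e) fun v hv => hN v (mem_verts.2 ⟨e, he, hv⟩)
    exact ⟨e₀, (mem_pullEdges ι).2 he, rfl⟩

/-- The pull-back has the same number of edges. [cite: BraunEtAl2016, Thm. 4.9 (proof)] -/
theorem card_pullEdges {N : Finset (KnEdge n)} (hN : ∀ v ∈ verts N, v ∈ Set.range ι) :
    (pullEdges ι N).card = N.card := by
  conv_rhs => rw [← map_pullEdges ι hN]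
  rw [card_map]

/-- **`polyEmbed ι (x_{N₀}) = x_N`** for the pull-back `N₀` of an edge set avoiding the missing
vertices. [cite: BraunEtAl2016, Thm. 4.9 (proof)] -/
theorem polyEmbed_xM_pullEdges {N : Finset (KnEdge n)} (hN : ∀ v ∈ verts N, v ∈ Set.range ι) :
    polyEmbed ι (xM (pullEdges ι N)) = xM N := by
  conv_rhs => rw [← map_pullEdges ι hN]
  rw [xM, xM, polyEmbed, map_prod, prod_map]
  simp only [rename_X, Function.Embedding.coeFn_mk]

/-- The pull-back of a partial matching is a partial matching. [cite: BraunEtAl2016, Thm. 4.9 (proof)] -/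
theorem isPartialMatching_pullEdges {N : Finset (KnEdge n)} (hN : IsPartialMatching N) :
    IsPartialMatching (pullEdges ι N) := by
  intro e he f hf hef v ⟨hve, hvf⟩
  rw [mem_pullEdges] at he hf
  refine hN _ he _ hf (fun h => hef (edgeMap_injective _ _ h)) (ι v) ⟨?_, ?_⟩
  · rw [coe_edgeMap, Sym2.mem_map]; exact ⟨v, hve, rfl⟩
  · rw [coe_edgeMap, Sym2.mem_map]; exact ⟨v, hvf, rfl⟩

/-! ### Extending perfect matchings by the missing edge -/

variable {ι} {a u : Fin n} (hau : a ≠ u) (hrange : ∀ v : Fin n, v ∉ Set.range ι ↔ v = a ∨ v = u)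

/-- `ι(P₀) ∪ {au}`. [cite: BraunEtAl2016, Thm. 4.9 (proof, "perfect matchings containing {a,b}")] -/
def extendPM (ι : Fin m ↪ Fin n) (a u : Fin n) (P₀ : Finset (Sym2 (Fin m))) : Finset (Sym2 (Fin n)) :=
  insert s(a, u) (P₀.image (Sym2.map ι))

include hrange in
/-- The image of `ι` as a finset is `{a, u}ᶜ`. [cite: BraunEtAl2016, Thm. 4.9 (proof)] -/
theorem image_univ_eq : (univ : Finset (Fin m)).image ι = univ \ {a, u} := by
  ext v
  simp only [mem_image, mem_univ, true_and, mem_sdiff, mem_insert, mem_singleton]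
  constructor
  · rintro ⟨w, rfl⟩ h
    exact ((hrange (ι w)).2 h) ⟨w, rfl⟩
  · intro h
    by_contra h'
    exact h ((hrange v).1 fun ⟨w, hw⟩ => h' ⟨w, hw⟩)

include hau hrange in
/-- **Extension of a perfect matching** of `K_m` to one of `K_n ⊇ ι(K_m) ∪ {a,u}`.
[cite: BraunEtAl2016, Thm. 4.9 (proof)] -/
theorem isPMOn_extendPM {P₀ : Finset (Sym2 (Fin m))} (hP₀ : IsPMOn univ P₀) :
    IsPMOn univ (extendPM ι a u P₀) := by
  classical
  have h1 : IsPMOn ((univ : Finset (Fin m)).image ι) (P₀.image (Sym2.map ι)) :=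
    hP₀.image ι (ι.injective.injOn)
  have h2 : IsPMOn ({a, u} : Finset (Fin n)) {s(a, u)} := IsPMOn.pair hau
  have h12 := h2.union h1 (by
    rw [image_univ_eq hrange]
    exact disjoint_sdiff)
  have huniv : ({a, u} ∪ (univ : Finset (Fin m)).image ι : Finset (Fin n)) = univ := by
    rw [image_univ_eq hrange, union_sdiff_of_subset (subset_univ _)]
  rw [huniv] at h12
  have hset : ({s(a, u)} ∪ P₀.image (Sym2.map ι) : Finset (Sym2 (Fin n))) = extendPM ι a u P₀ := by
    rw [extendPM, insert_eq]
  rw [hset] at h12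
  exact h12

include hrange in
/-- An image edge is not the new edge `{a,u}`. [cite: BraunEtAl2016, Thm. 4.9 (proof)] -/
theorem map_ne_pair (e₀ : Sym2 (Fin m)) : Sym2.map ι e₀ ≠ s(a, u) := by
  intro h
  have : a ∈ Sym2.map ι e₀ := by rw [h]; exact Sym2.mem_mk_left _ _
  rw [Sym2.mem_map] at this
  obtain ⟨w, -, hw⟩ := this
  exact ((hrange a).2 (Or.inl rfl)) ⟨w, hw⟩

include hrange in
/-- **Evaluation transport**: `(polyEmbed ι A₀)(χ^{ι(P₀) ∪ {au}}) = A₀(χ^{P₀})`.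
[cite: BraunEtAl2016, Thm. 4.9 (proof, "L' is zero on all perfect matchings containing {a,b} and {u,v}")] -/
theorem eval_polyEmbed_extendPM (P₀ : Finset (Sym2 (Fin m))) (A₀ : MvPolynomial (KnEdge m) ℝ) :
    eval (edgeIndicator (extendPM ι a u P₀)) (polyEmbed ι A₀) = eval (edgeIndicator P₀) A₀ := by
  classical
  rw [polyEmbed, eval_rename]
  have hfun : edgeIndicator (extendPM ι a u P₀) ∘ edgeMap ι ι.injective = edgeIndicator P₀ := by
    funext e₀
    simp only [Function.comp_apply, edgeIndicator_apply, coe_edgeMap, extendPM, mem_insert,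
      map_ne_pair hrange, false_or]
    exact if_congr ((Sym2.map.injective ι.injective).mem_finset_image) rfl rfl
  rw [hfun]

/-- On the extended matching, `x_{au} = 1`. [cite: BraunEtAl2016, Thm. 4.9 (proof)] -/
theorem eval_X_pair_extendPM (P₀ : Finset (Sym2 (Fin m))) :
    eval (edgeIndicator (extendPM ι a u P₀)) (X ⟨s(a, u), fun h => hau (Sym2.mk_isDiag_iff.1 h)⟩) = 1 := by
  classical
  rw [eval_X, edgeIndicator_apply, if_pos]
  exact mem_insert_self _ _

include hrange in
/-- On the extended matching, every OTHER edge at `a` (or at `u`) is absent: `x_e = 0` for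
`a ∈ e ≠ {a,u}`. [cite: BraunEtAl2016, Thm. 4.9 (proof)] -/
theorem eval_X_eq_zero_extendPM (P₀ : Finset (Sym2 (Fin m))) {e : KnEdge n}
    (hae : a ∈ (e : Sym2 (Fin n)) ∨ u ∈ (e : Sym2 (Fin n))) (hne : (e : Sym2 (Fin n)) ≠ s(a, u)) :
    eval (edgeIndicator (extendPM ι a u P₀)) (X e) = 0 := by
  classical
  rw [eval_X, edgeIndicator_apply, if_neg]
  rw [extendPM, mem_insert, not_or]
  refine ⟨hne, fun h => ?_⟩
  obtain ⟨e₀, -, he₀⟩ := mem_image.1 h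
  rcases hae with hae | hae
  · have : a ∈ Sym2.map ι e₀ := by rw [he₀]; exact hae
    rw [Sym2.mem_map] at this
    obtain ⟨w, -, hw⟩ := this
    exact ((hrange a).2 (Or.inl rfl)) ⟨w, hw⟩
  · have : u ∈ Sym2.map ι e₀ := by rw [he₀]; exact hae
    rw [Sym2.mem_map] at this
    obtain ⟨w, -, hw⟩ := this
    exact ((hrange u).2 (Or.inr rfl)) ⟨w, hw⟩

end Mod2

end Literature.Computability.Complexity
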